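import Summits.SmoothPoincare4.SmoothPoincare4.Theses.ConvexBisection

/-!
# Line `sparse-arrangement-cap` for crux `ConvexBisection.AcyclicBisectionRigidity` (stmt-SmoothPoincare4-10507)

Skeleton (crux-plan, planner-cruxplan-stmt-SmoothPoincare4-10507-sparse-arrangement-c-0, 2026-08-15) of idea
card `Cruxes/AcyclicBisectionRigidity/Ideas/sparse-arrangement-cap.md` with the three triage sharpenings
(TRIAGE-r1-1 … r1-3: sparsity = `k − 1` discs and `k − 1` marked points, i.e. ℚ-acyclicity; the isotopy
statement must fix the boundary open book; the endgame is NOT "⇒ double `D(W)`" but T3′/T3″ = twisted doubles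
of ONE planar body by a symmetry of the supporting open book; the line lives on the PLANAR sector).

SECTOR. The lever needs a planar supporting open book of the seam (to build Etnyre's cap), so the line decides
the planar sector `PlanarBisectionRigidity` (stmt-SmoothPoincare4-10511) UNCONDITIONALLY from the stubs
(`PlanarBisectionRigidity_of`) and reaches THIS crux through the route's own support item `PlanarBisectionExists`
(stmt-SmoothPoincare4-10512) BY NAME (`AcyclicBisectionRigidity_of`), exactly along the route's two-layer plan
E-b/E-c (planarise, then rigidity). The crux's own acyclic-bisection hypothesis is not consumed: its seam need not
be planar (`S⁴ = D(W¹)` with the Karakurt–Oba–Ukida NON-planar Stein structure `J₁` on the Akbulut cork is an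
acyclic bisection outside the lever's reach, arXiv:1607.07661 Thm 1.2), so the line re-bisects the same `M`
planarly through the support item instead (Disproof §1: every such re-routing stays SPC4-implied, nothing is lost).

THE LINE (notation: `Γ = ∂W₁` the seam with contact structure `ξ₁ = contactPlane J₁.J`, `ψ = e₂⁻¹ ∘ e₁|∂W₁`
the seam contactomorphism, `(B, π)` = `ob` a planar open book supporting `ξ₁` with `k = ob.k` binding components,
`K` = Etnyre's cap = `k` two-handles on `B` with page framing `∪ S² × D²` = the braided-star neighbourhood
`N(S ∪ S₁ ∪ … ∪ S_k)`, `Zᵢ = Wᵢ ∪ K` glued along the SAME seam, `R_k = S² × S² # (k−1) CP²-bar`):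
* `stub_planarAcyclic` (E-c of the route, KNOWN modulo vendoring): planar seam ⇒ both halves ℚ-acyclic
  (Etnyre 2004 Thm 4.1 twice — `ξ₂ = ψ_*ξ₁` is planar too — gives `b₂⁺ = b₂⁰ = 0`; the intersection forms
  vanish inside the homology sphere, so `b₂ = 0`; Mayer–Vietoris `H₃(Γ;ℚ) ≅ H₄(M;ℚ)` makes `Γ` connected and
  the Euler count `χ(W₁) + χ(W₂) = 2` kills `b₁`). This is the SPARSITY the lever grips: each half is a planar
  Lefschetz fibration (Wendl) with `k − 1` vanishing cycles = an arrangement of `k − 1` graphical symplectic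
  discs with `k − 1` marked points (Plamenevskaya–Starkston), and `b₂(Zᵢ) = k + 1` has no room beyond the cap.
* `stub_planarTwins` (S1 ∧ S2 ∧ S3 of the card, the LEVER, new): the two halves are diffeomorphic, by an
  `F : W₁ ≅ W₂` whose seam mismatch `h = ψ⁻¹ ∘ F|∂` (read on a boundary datum `b`) is a SYMMETRY of some planar
  open book `ob` supporting `ξ₁` (`h(B) = B`, `π ∘ h = ρ ∘ π` off `B`) — the seam becomes VISIBLE as `ĉ ∈ Aut(P_k, φ)`.
  Intended proof: S1 common cap — `Z₁`, `Z₂` are closed, simply connected (`π₁Γ ↠ π₁Wᵢ`, `π₁K = 1`), symplectic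
  with the square-0 sphere `S`, hence rational (McDuff 1990) with `b₂ = k + 1`, so `Z₁ ≅ Z₂ ≅ R_k` and
  `Wᵢ = R_k ∖ ιᵢ(K)°` for two symplectic embeddings of ONE configuration `C = S ∪ ⋃ Sⱼ` = fibre + `k` `J`-sections;
  S2 SPARSE ARRANGEMENT ISOTOPY — such configurations in fixed classes with fixed boundary open book are
  symplectically isotopic (≡ planar minimal-factorisation rigidity of card `minimal-factorisation-rigidity` via
  the PS dictionary) — so `Θ ∘ ι₁ = ι₂ ∘ μ` with `Θ : Z₁ ≅ Z₂` and a CAP SYMMETRY `μ ∈ Diff(K, C)`, and `Θ`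
  restricts to `F : W₁ ≅ W₂` with seam mismatch `μ|∂K`; S3 CAP MONODROMY IS AN OPEN-BOOK SYMMETRY — a
  diffeomorphism of the plumbing `K` preserving the core spheres preserves, up to isotopy, the open book the
  ruling cuts on `∂K`; the residual isotopy is absorbed into `F` in a collar. As a statement it contains card 1's
  `AcyclicTwinsDiffeomorphic` on the planar sector (Disproof §6 target); NOT SPC4-implied; falsifiable by one
  exotic pair of planar acyclic fillings with contactomorphic boundaries, or by a contact cork twist of a planar
  acyclic body that is no open-book symmetry modulo extendable diffeomorphisms. Honours Disproof §5b: `h` may move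
  `ker(H₁Γ → H₁W₁)` (the `S³/Q₈` rational contact cork); the stub does NOT claim `h` extends over `W₁` (UQF*, refuted).
* `stub_twinStandard` (T3′/T3″ of the triage, the RESIDUAL, shared with card `minimal-factorisation-rigidity`
  and with crux 3546 at `h = id`): a homotopy 4-sphere which is the `h`-twisted double `W₁ ∪_h W̄₁` of ONE
  ℚ-acyclic planar Stein domain by a symmetry `h` of a supporting planar open book is `S⁴` (in Wendl normal
  form: `X_F ∪_ĉ X̄_F ≃ S⁴ ⇒ ≅ S⁴` for `c ∈ Aut(P_k, φ)`; contains the planar presentation spheres at `h = id`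
  and the `S³/Q₈` instance, standard by Price / Kim–Miller, if that seam is planar). SPC4-implied (shape
  `∀ M ≃ₕ S⁴, P M → M ≅ S⁴`, Disproof §1), hence only provable, not refutable.
* `PlanarBisectionRigidity_of` and `AcyclicBisectionRigidity_of (hP : PlanarBisectionExists)` — the
  kernel-checked compositions (pure logic).

Disproof.lean (cdisprove gen 2, v8, tree copy read 2026-08-15) honoured: `false_without_homotopyEquiv` — every
stub that concludes a diffeomorphism WITH `S⁴` keeps `M ≃ₕ S⁴` (`stub_twinStandard`; the twins stub keeps it
too, as the trivial-π₁-pushout side condition of the isotopy statement); `collapse_without_acyclic` /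
rattack `mutation_drop_acyclic_collapses_to_spc4` — acyclicity is an explicit hypothesis of the lever stub and
is where sparsity comes from (`stub_planarAcyclic` derives it from planarity, Etnyre); §5b (`f2sq_transvection`,
`f2sq_mayer_vietoris`, `sup_eq_top_of_index_eq_two`) — no stub concludes "double" or "rel-boundary unique"; §6 —
`stub_planarTwins` is the planar restriction of the target `AcyclicTwinsDiffeomorphic`, its cheapest falsifier
(Akbulut–Yildiz / HMP pairs: are `ξ_{J₁}`, `ξ_{J₂}` contactomorphic AND planar?) is recorded in the line card;
§8 transport gap — the compositions never move a bisection along a diffeomorphism (no `IsSmoothEmbedding.comp`).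
Negative/ lemmas landed for this crux: none (2026-08-15); negatives index: 0 refuted statements.
-/

namespace Summit.SmoothPoincare4.SmoothPoincare4.Cruxes.AcyclicBisectionRigidity.SparseArrangementCap

open scoped Manifold ContDiff Topology ContinuousMap
open Set Function
open Summit.SmoothPoincare4.SmoothPoincare4.Theses.ConvexBisection
open Literature.Geometry.Symplectic Literature.Topology.FourManifolds
open Literature.AlgebraicTopology.SingularHomology CategoryTheory.Limits

set_option linter.unusedVariables false
set_option linter.dupNamespace false

/-- **E-c — planar seams force ℚ-acyclic halves (KNOWN modulo vendoring; Etnyre 2004 Thm 4.1 + Mayer–Vietoris).**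
For a Hausdorff second-countable smooth `M ≃ₕ S⁴` covered by two smoothly embedded compact Stein domains
`(W₁,J₁)`, `(W₂,J₂)` meeting exactly along the images of their boundaries, with equal pushed-forward complex
tangencies on the seam, and with `(∂W₁, ξ₁)` planar: `H_k(W₁;ℚ) = H_k(W₂;ℚ) = 0` for all `k > 0`.
Why true: the seam identification is a contactomorphism, so `(∂W₂, ξ₂)` is planar as well; Etnyre
(arXiv:math/0404267, Thm 4.1, p. 9: a symplectic filling of a planar contact manifold has `b₂⁺ = b₂⁰ = 0` and
connected boundary) applied to both Stein halves; the intersection form of a codimension-0 piece of the homology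
4-sphere `M` vanishes (`H₂(Wᵢ;ℚ) → H₂(M;ℚ) = 0`), and `b₂⁰ = 0` then forces `b₂(Wᵢ) = 0`; `H₃(Wᵢ;ℚ) = H₄ = 0`
for Stein domains (handles of index ≤ 2, connected boundary per component); Mayer–Vietoris gives
`H₃(Γ;ℚ) ≅ H₄(M;ℚ) ≅ ℚ` (seam connected) and `χ(W₁) + χ(W₂) = χ(M) + χ(Γ) = 2`, whence `b₁(Wᵢ) = 0`
(`H₁(∂Wᵢ) ↠ H₁(Wᵢ)`, `χ(Wᵢ) = 1 − b₁ ≤ 1`). Formal size L: needs Etnyre's theorem as a cite fact and a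
Mayer–Vietoris / Euler-characteristic interface for the tree's `singularHomology` (none yet, Disproof §8).
This is also the route's step E-c (`PlanarBisectionExists → AcyclicBisectionExists`). -/
theorem stub_planarAcyclic :
    ∀ (M : Type) [TopologicalSpace M] [T2Space M] [SecondCountableTopology M]
      [ChartedSpace (EuclideanSpace ℝ (Fin 4)) M] [IsManifold (𝓡 4) ∞ M],
      M ≃ₕ Metric.sphere (0 : EuclideanSpace ℝ (Fin 5)) 1 →
    ∀ (W₁ : Type) [TopologicalSpace W₁] [ChartedSpace (EuclideanHalfSpace 4) W₁]
      [IsManifold (𝓡∂ 4) ∞ W₁] [CompactSpace W₁] (W₂ : Type) [TopologicalSpace W₂]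
      [ChartedSpace (EuclideanHalfSpace 4) W₂] [IsManifold (𝓡∂ 4) ∞ W₂] [CompactSpace W₂]
      (J₁ : SteinStructure W₁) (J₂ : SteinStructure W₂) (e₁ : W₁ → M) (e₂ : W₂ → M),
    Manifold.IsSmoothEmbedding (𝓡∂ 4) (𝓡 4) ∞ e₁ → Manifold.IsSmoothEmbedding (𝓡∂ 4) (𝓡 4) ∞ e₂ →
    range e₁ ∪ range e₂ = univ →
    range e₁ ∩ range e₂ = e₁ '' (𝓡∂ 4).boundary W₁ →
    range e₁ ∩ range e₂ = e₂ '' (𝓡∂ 4).boundary W₂ →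
    (∀ w₁ w₂, e₁ w₁ = e₂ w₂ →
      Submodule.map (mfderiv (𝓡∂ 4) (𝓡 4) e₁ w₁).toLinearMap (contactPlane J₁.J w₁) =
        Submodule.map (mfderiv (𝓡∂ 4) (𝓡 4) e₂ w₂).toLinearMap (contactPlane J₂.J w₂)) →
    PlanarContactBoundary J₁ →
    ∀ k, 0 < k → IsZero (singularHomology ℚ ℚ W₁ k) ∧ IsZero (singularHomology ℚ ℚ W₂ k) := by
  sorry

/-- **S1 ∧ S2 ∧ S3 — planar acyclic twins are ONE body re-glued by a symmetry of a planar open book (the LEVER; NEW).**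
In a common-contact Stein bisection of a homotopy 4-sphere with ℚ-acyclic halves and planar seam there are: a boundary datum `b` of
`W₁`, a PLANAR open book `ob` on it supporting the pulled-back complex tangencies `ξ₁`, a diffeomorphism `F : W₁ ≅ W₂` of the
halves, a diffeomorphism `h` of the boundary 3-manifold and a homeomorphism `ρ` of the circle of pages such that `h` IS the seam
mismatch of `F` read on `b` — `e₂ (F (b.incl y)) = e₁ (b.incl (h y))`, i.e. `h = ψ⁻¹ ∘ F|∂W₁` with `ψ = e₂⁻¹ ∘ e₁` the seam
gluing — and `h` is a SYMMETRY of `ob`: it preserves the binding and permutes the pages (`π ∘ h = ρ ∘ π` off the binding). So the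
halves are diffeomorphic (card `minimal-factorisation-rigidity`'s `AcyclicTwinsDiffeomorphic` on the planar sector, Disproof §6
target) AND the seam is VISIBLE IN AN OPEN BOOK: `M ≅ W₁ ∪_h W̄₁ = X_F ∪_ĉ X̄_F` with `c ∈ Aut(P_k, φ)` in Wendl's normal form.
Intended proof (card `sparse-arrangement-cap`): S1 COMMON CAP — glue Etnyre's cap `K` (two-handles on the `k` binding components
with page framing, then `S² × D²`; arXiv:math/0404267 p. 9) to BOTH halves along the common seam; `Zᵢ = Wᵢ ∪ K` is closed, simply
connected (`π₁Γ ↠ π₁Wᵢ`, `π₁K = 1`), symplectic with a square-0 sphere `S`, hence rational (McDuff 1990) with `b₂ = k + 1`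
(acyclicity: `χ(Zᵢ) = 1 + (k + 2)`), so `Z₁ ≅ Z₂ ≅ R_k = S²×S² # (k−1)CP²-bar` and `W₁`, `W₂` are the complements of two symplectic
embeddings `ι₁, ι₂ : K → R_k` of ONE configuration `C = S ∪ S₁ ∪ … ∪ S_k` (a fibre and `k` `J`-holomorphic sections ↔ a
Plamenevskaya–Starkston arrangement of `k − 1` graphical discs with `k − 1` marked points, arXiv:2006.06631 Thms 1.4–1.5).
S2 SPARSE ARRANGEMENT ISOTOPY — such configurations, in fixed homology classes and with fixed boundary open book `(P_k, φ)`, are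
symplectically isotopic (the regime of the known uniqueness results: Lisca 2008, the rational-ball filling of `(L(p,q), ξ_can)` is
unique up to diffeomorphism, quoted in Etnyre–Ozbagci–Tosun arXiv:2408.09292 p. 3; Golla–Starkston arXiv:1907.06787; by the PS
dictionary ≡ Hurwitz transitivity of minimal planar factorisations, card 1's T2) — gives `Θ : Z₁ ≅ Z₂` and a CAP SYMMETRY
`μ ∈ Diff(K, C)` with `Θ ∘ ι₁ = ι₂ ∘ μ`; `Θ` restricts to `F : W₁ ≅ W₂` with seam mismatch `μ|∂K`. S3 CAP MONODROMY IS AN OPEN-BOOK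
SYMMETRY — a diffeomorphism of the plumbing `K` preserving each core sphere preserves, up to isotopy, the open book that the ruling
cuts on `Γ = ∂K` (mapping-torus part over `S°`, binding tubes from the `S_j`); absorb the isotopy into `F` inside a collar of `∂W₂`
and move `ob` by Gray stability so that it supports `ξ₁` on the nose. NOT implied by SPC4 (it produces a diffeomorphism of the
HALVES and a boundary symmetry, not of `M`); stated ∃-over-`ob` (the line picks the open book it caps). Why it might fail: (i) an
exotic pair of ℚ-acyclic Stein fillings of one planar contact manifold in the homotopy-sphere pattern (Akbulut–Yildiz
arXiv:1901.00806 Thm 1 / Hayden–Mark–Piccirillo arXiv:1908.05269 §6.0.1 pairs, IF their contact structures are contactomorphic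
AND planar — not computed in print); (ii) a Stein-compatible cork twist of a planar acyclic body that is no open-book symmetry
modulo `W₁`-extendable diffeomorphisms — first test (card falsifier (ii)): Ukida's planar PALF of the Akbulut cork
(arXiv:1406.5865; KOU arXiv:1607.07661 Prop 2.3, `k = 5`) against its image under the cork involution `τ`, IF `τ^*ξ₂ ≃ ξ₂`.
Honours Disproof §5b: `h` may act non-trivially on `H₁(Γ)` (the `S³/Q₈` rational contact cork); nothing asks `h` to extend over
`W₁` (that was UQF*, refuted). Size XL (S1 known modulo vendoring; S2 the engine: pseudo-holomorphic sections of blown-up ruled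
surfaces, or Garside/Hurwitz in `PB_{k−1}`; S3 plumbing bookkeeping + Giroux/Gray). -/
theorem stub_planarTwins :
    ∀ (M : Type) [TopologicalSpace M] [T2Space M] [SecondCountableTopology M]
      [ChartedSpace (EuclideanSpace ℝ (Fin 4)) M] [IsManifold (𝓡 4) ∞ M],
      M ≃ₕ Metric.sphere (0 : EuclideanSpace ℝ (Fin 5)) 1 →
    ∀ (W₁ : Type) [TopologicalSpace W₁] [ChartedSpace (EuclideanHalfSpace 4) W₁]
      [IsManifold (𝓡∂ 4) ∞ W₁] [CompactSpace W₁] (W₂ : Type) [TopologicalSpace W₂]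
      [ChartedSpace (EuclideanHalfSpace 4) W₂] [IsManifold (𝓡∂ 4) ∞ W₂] [CompactSpace W₂]
      (J₁ : SteinStructure W₁) (J₂ : SteinStructure W₂) (e₁ : W₁ → M) (e₂ : W₂ → M),
    Manifold.IsSmoothEmbedding (𝓡∂ 4) (𝓡 4) ∞ e₁ → Manifold.IsSmoothEmbedding (𝓡∂ 4) (𝓡 4) ∞ e₂ →
    range e₁ ∪ range e₂ = univ →
    range e₁ ∩ range e₂ = e₁ '' (𝓡∂ 4).boundary W₁ →
    range e₁ ∩ range e₂ = e₂ '' (𝓡∂ 4).boundary W₂ →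
    (∀ w₁ w₂, e₁ w₁ = e₂ w₂ →
      Submodule.map (mfderiv (𝓡∂ 4) (𝓡 4) e₁ w₁).toLinearMap (contactPlane J₁.J w₁) =
        Submodule.map (mfderiv (𝓡∂ 4) (𝓡 4) e₂ w₂).toLinearMap (contactPlane J₂.J w₂)) →
    (∀ k, 0 < k → IsZero (singularHomology ℚ ℚ W₁ k) ∧ IsZero (singularHomology ℚ ℚ W₂ k)) →
    PlanarContactBoundary J₁ →
    ∃ (b : BoundaryData (𝓡∂ 4) W₁ (𝓡 3)) (ob : OpenBook b.carrier),
      ob.IsPlanar ∧ ob.Supports (boundaryPlaneField J₁.J b) ∧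
      ∃ (F : W₁ ≃ₘ⟮𝓡∂ 4, 𝓡∂ 4⟯ W₂) (h : b.carrier ≃ₘ⟮𝓡 3, 𝓡 3⟯ b.carrier)
        (ρ : (Metric.sphere (0 : EuclideanSpace ℝ (Fin 2)) 1) ≃ₜ (Metric.sphere (0 : EuclideanSpace ℝ (Fin 2)) 1)),
        (∀ y : b.carrier, e₂ (F (b.incl y)) = e₁ (b.incl (h y))) ∧
        h '' ob.binding = ob.binding ∧
        (∀ y : b.carrier, y ∉ ob.binding → ob.proj (h y) = ρ (ob.proj y)) := by
  sorry

/-- **T3′ — open-book-symmetric twisted doubles of a planar acyclic Stein domain are standard (the RESIDUAL).**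
Let `M ≃ₕ S⁴` be Hausdorff second-countable smooth, covered by smooth embeddings `e₁ : W₁ → M`, `e₂ : W₂ → M`
of compact 4-manifolds meeting exactly along the images of their boundaries, where `(W₁, J₁)` is a ℚ-acyclic
Stein domain whose boundary complex tangencies (read on a boundary datum `b`) are supported by a PLANAR open
book `ob`, and where `W₂` is a copy of `W₁` (`F : W₁ ≅ W₂`) glued back by a SYMMETRY `h` of `ob`
(`e₂ ∘ F ∘ b.incl = e₁ ∘ b.incl ∘ h`, `h(B) = B`, `π ∘ h = ρ ∘ π` off `B`) — i.e. `M = W₁ ∪_h W̄₁` is an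
open-book-symmetric twisted double of ONE planar acyclic Stein body. Then `M ≅ S⁴`. In Wendl normal form
(arXiv:0806.3193 Thm 1: `W₁ ≅ X_F`, a planar Lefschetz fibration over `(P_k, φ)` with `k − 1` vanishing cycles)
this is the triage's T3′: `X_F ∪_ĉ X̄_F ≃ S⁴ ⇒ ≅ S⁴` for `c ∈ Aut(P_k, φ)`; it contains the planar
presentation spheres (`h = id`, `W₁` contractible: `D(W₁) = ∂(W₁ × I)`, Andrews–Curtis-adjacent but with
relators = embedded curves on one planar page, card 1's T4 remark; known for Mazur-type / admissible-link bodies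
by Property R) and the `S³/Q₈` instance of Disproof §5b if that seam is planar (standard by Price 1977 /
Kim–Miller arXiv:1805.00429 §3.1). IMPLIED BY SPC4 (Disproof §1 `shielded_of_spc4`: shape `∀ M ≃ₕ S⁴, P M →
M ≅ S⁴`), so it can only be proved, never refuted; `M ≃ₕ S⁴` is kept (Disproof `false_without_homotopyEquiv`;
without it `D(B_{p,q})`-type twisted doubles have `π₁ ≠ 1`). No contact-matching hypothesis is needed here: the
Stein/planar data of `W₁` alone put both copies over one open book. Hardest stub of the line; size XL;
shared residual with card `minimal-factorisation-rigidity` (T3′ ∧ T4) and, at `h = id` with `W₁` contractible,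
with crux `ContractibleTwistedDoubleStandard` (stmt-SmoothPoincare4-3546). -/
theorem stub_twinStandard :
    ∀ (M : Type) [TopologicalSpace M] [T2Space M] [SecondCountableTopology M]
      [ChartedSpace (EuclideanSpace ℝ (Fin 4)) M] [IsManifold (𝓡 4) ∞ M],
      M ≃ₕ Metric.sphere (0 : EuclideanSpace ℝ (Fin 5)) 1 →
    ∀ (W₁ : Type) [TopologicalSpace W₁] [ChartedSpace (EuclideanHalfSpace 4) W₁]
      [IsManifold (𝓡∂ 4) ∞ W₁] [CompactSpace W₁] (W₂ : Type) [TopologicalSpace W₂]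
      [ChartedSpace (EuclideanHalfSpace 4) W₂] [IsManifold (𝓡∂ 4) ∞ W₂] [CompactSpace W₂]
      (J₁ : SteinStructure W₁) (e₁ : W₁ → M) (e₂ : W₂ → M),
    Manifold.IsSmoothEmbedding (𝓡∂ 4) (𝓡 4) ∞ e₁ → Manifold.IsSmoothEmbedding (𝓡∂ 4) (𝓡 4) ∞ e₂ →
    range e₁ ∪ range e₂ = univ →
    range e₁ ∩ range e₂ = e₁ '' (𝓡∂ 4).boundary W₁ →
    range e₁ ∩ range e₂ = e₂ '' (𝓡∂ 4).boundary W₂ →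
    (∀ k, 0 < k → IsZero (singularHomology ℚ ℚ W₁ k)) →
    ∀ (b : BoundaryData (𝓡∂ 4) W₁ (𝓡 3)) (ob : OpenBook b.carrier),
      ob.IsPlanar → ob.Supports (boundaryPlaneField J₁.J b) →
    ∀ (F : W₁ ≃ₘ⟮𝓡∂ 4, 𝓡∂ 4⟯ W₂) (h : b.carrier ≃ₘ⟮𝓡 3, 𝓡 3⟯ b.carrier)
      (ρ : (Metric.sphere (0 : EuclideanSpace ℝ (Fin 2)) 1) ≃ₜ (Metric.sphere (0 : EuclideanSpace ℝ (Fin 2)) 1)),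
      (∀ y : b.carrier, e₂ (F (b.incl y)) = e₁ (b.incl (h y))) →
      h '' ob.binding = ob.binding →
      (∀ y : b.carrier, y ∉ ob.binding → ob.proj (h y) = ρ (ob.proj y)) →
    Nonempty (M ≃ₘ⟮𝓡 4, 𝓡 4⟯ Metric.sphere (0 : EuclideanSpace ℝ (Fin 5)) 1) := by
  sorry

/-- **The planar sector, decided by the stubs (kernel-checked, no `sorry` of its own): `PlanarBisectionRigidity`
(stmt-SmoothPoincare4-10511).** Unpack the planar bisection; `stub_planarAcyclic` gives sparsity; `stub_planarTwins`
a diffeomorphism of the halves whose seam mismatch is a symmetry of a planar supporting open book; `stub_twinStandard`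
recognises `S⁴`. -/
theorem PlanarBisectionRigidity_of : PlanarBisectionRigidity := by
  intro M _ _ _ _ _ e hb
  obtain ⟨W₁, _, _, _, _, W₂, _, _, _, _, J₁, J₂, e₁, e₂, h₁, h₂, hc, hs₁, hs₂, hξ, hpl⟩ := hb
  have hac := stub_planarAcyclic M e W₁ W₂ J₁ J₂ e₁ e₂ h₁ h₂ hc hs₁ hs₂ hξ hpl
  obtain ⟨b, ob, hobpl, hsup, F, h, ρ, hrel, hbind, hproj⟩ :=
    stub_planarTwins M e W₁ W₂ J₁ J₂ e₁ e₂ h₁ h₂ hc hs₁ hs₂ hξ hac hpl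
  exact stub_twinStandard M e W₁ W₂ J₁ e₁ e₂ h₁ h₂ hc hs₁ hs₂ (fun k hk => (hac k hk).1)
    b ob hobpl hsup F h ρ hrel hbind hproj

/-- **The crux, through the planar sector: `PlanarBisectionExists → AcyclicBisectionRigidity`** (kernel-checked;
the route's support item stmt-SmoothPoincare4-10512 enters BY NAME, as the sibling crux does in
`CompactShrinkerGap/Lines/decay-climb-numax`). Given `M ≃ₕ S⁴` (its own acyclic bisection is discarded — its seam
need not be planar), `PlanarBisectionExists` supplies a planar common-contact Stein bisection of the SAME `M`, and
`PlanarBisectionRigidity_of` concludes. -/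
theorem AcyclicBisectionRigidity_of (hP : PlanarBisectionExists) : AcyclicBisectionRigidity := by
  intro M _ _ _ _ _ e _
  obtain ⟨W₁, _, _, _, _, W₂, _, _, _, _, J₁, J₂, e₁, e₂, h₁, h₂, hc, hs₁, hs₂, hξ, hpl, -⟩ := hP M e
  exact PlanarBisectionRigidity_of M e
    ⟨W₁, _, _, _, _, W₂, _, _, _, _, J₁, J₂, e₁, e₂, h₁, h₂, hc, hs₁, hs₂, hξ, hpl⟩

end Summit.SmoothPoincare4.SmoothPoincare4.Cruxes.AcyclicBisectionRigidity.SparseArrangementCap
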